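import Literature.AlgebraicGeometry.Resolution.RelAlgClosedImmediate
import Literature.AlgebraicGeometry.Resolution.Kuhlmann2019Prop52FirstSteps
import Literature.AlgebraicGeometry.Resolution.HenselizationDirectedUnion
import Mathlib.FieldTheory.AlgebraicClosure
import HarnessLib

/-!
# The valuative input of Temkin's Thm. 3.3.1 in residue characteristic `0`

Topic: `Literature/AlgebraicGeometry/Resolution` (valued function fields). Groundwork for the
assembly of M. Temkin, *Inseparable local uniformization*, J. Algebra 373 (2013) 65–119 =
arXiv:0804.1554v3, Thm. 3.3.1 (tree: the named fact `Temkin2013RelativeCurveSmoothFibre`,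
`InseparableLocalUniformizationCurvesStepOne.lean`), which is stated for ground valued fields of
height one in ALL equal characteristics (`ringChar k̃ = ringChar k`; Thm. 4.1.1 invokes it so).
Its valuation-theoretic input (Thms. 3.2.3, 3.2.6; read in henselizations as in
`DeeplyRamifiedKrasner.lean`, "Reading notes") asserts, for a transcendentally immediate
function field `F|k` of transcendence degree one: finite purely inseparable `l/k`, finite
separable `m/l` inside `(lF)^h`, and `t ∈ lF·m` with `lF·m ⊆ m(t)^h`. In residue characteristic
`p > 0` this is the deep part of the paper (§3.1–3.2, the companion files `DeeplyRamified*.lean`,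
`Kuhlmann2019*.lean`). In residue characteristic `0` it is elementary, and PROVED here with
`l = k` and ANY `t ∈ F` transcendental over `k`:

> there is a finite set `s ⊆ F^h` of elements algebraic over `k` with
> `F ≤ k(s)(t)^h` (hence `F·k(s) ≤ (k(s)(t))^h`, and `k(s) ≤ F^h`).

Mechanism (classical; Temkin's remark that the mixed/zero characteristic cases are "essentially
the same" but simpler, Remark 3.2.7, and Kuhlmann 2019, Thm. 1.3 with an empty tower of
degree-`p` steps): let `C` be the relative algebraic closure of `k` in `F^h`. By Hensel's Lemma in
the henselian `F^h` of residue characteristic `0`, residues of `F^h` algebraic over `Cv` lift to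
`C` and torsion values over `vC` are values of `C` (roots of `1`-units of every order exist), so
`F^h|C` is IMMEDIATE (`isImmediateOver_of_forall_isAlgebraic_mem_of_charZero`, the
characteristic-`0` twin of `RelAlgClosedImmediate.lean`); an immediate algebraic extension of the
henselian `C(t)^h` inside `F^h` is trivial in residue characteristic `0` (Ostrowski: no defect;
tree: `le_henselization_closure_of_isImmediateOver`, `Kuhlmann2019Prop52FirstSteps.lean`), so
`F·C ≤ C(t)^h`; finally `C = ⋃ k(s)` over finite `s ⊆ C` and the henselization of a directed union
is the union of the henselizations (`HenselizationDirectedUnion.lean`), so finitely many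
generators of `F` lie in one `k(s)(t)^h`.

* `residue_mem_resField_of_forall_isAlgebraic_mem_of_charZero`,
  `exists_valuation_eq_of_forall_isAlgebraic_mem_of_charZero`,
  `isImmediateOver_of_forall_isAlgebraic_mem_of_charZero` — the characteristic-`0` twins of
  `RelAlgClosedImmediate.lean` (no perfectness needed) — PROVED;
* `isImmediateOver_algebraicPart_henselization_of_charZero` — for `k ≤ F` with `vF/vk` torsion
  and `Fv|kv` algebraic: `F^h` is immediate over `C = F^h ∩ k̃` — PROVED;
* `exists_finset_le_henselization_closure_of_charZero` — **the valuative input of Thm. 3.3.1 in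
  residue characteristic `0`** — PROVED.

All statements are [folklore] valuation theory (F.-V. Kuhlmann, Trans. AMS 362 (2010), §§1.1,
2.2, 2.3 Cor. 2.12; Israel J. Math. 234 (2019), proof of Prop. 5.2); no definitions, no named
facts.

## Sources

* M. Temkin, J. Algebra 373 (2013) = arXiv:0804.1554: §3.2 (Thms. 3.2.3, 3.2.6, Remark 3.2.7),
  §3.3 (Thm. 3.3.1 and its proof, Step 2), pp. 24–27 of the held arXiv text. [Temkin2013]
* F.-V. Kuhlmann, *Elimination of ramification I*, Trans. AMS 362 (2010) = arXiv:1003.5678: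
  §1.1, §2.2, Cor. 2.12, through the tree. [Kuhlmann2010]
* F.-V. Kuhlmann, *Elimination of ramification II*, Israel J. Math. 234 (2019) =
  arXiv:1701.05508: proof of Prop. 5.2 (residue characteristic `0`: empty tower), through the
  tree (`le_henselization_closure_of_isImmediateOver`). [Kuhlmann2019]
-/

noncomputable section

namespace Literature.AlgebraicGeometry.Resolution

universe u

open Polynomial IsLocalRing

variable {Ω : Type u} [Field Ω] (V : ValuationSubring Ω)

/-! ### Residue characteristic `0`: no new algebraic residues, no new torsion values -/

section CharZero

variable [CharZero (ResidueField V)]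

/-- **Residues: no new algebraic residues (residue characteristic `0`).** Let `C ≤ E ≤ Ω` be
subfields with `(E, V ∩ E)` henselian and such that every element of `E` algebraic over `C` lies
in `C`. Then every residue of an element of `V ∩ E` which is algebraic over `Cv` lies in `Cv`
(its minimal polynomial is separable, `Cv` having characteristic `0`; lift it and apply Hensel's
Lemma in `E`). [folklore] -/
theorem residue_mem_resField_of_forall_isAlgebraic_mem_of_charZero {C E : Subfield Ω}
    (hCE : C ≤ E) (hE : IsHenselianField E (V.comap (algebraMap E Ω)))
    (hrel : ∀ a ∈ E, IsAlgebraic C a → a ∈ C) {r : Ω} (hrE : r ∈ E) (hrV : r ∈ V)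
    (halg : IsAlgebraic (resField V C) (residue V ⟨r, hrV⟩)) :
    residue V ⟨r, hrV⟩ ∈ resField V C := by
  classical
  haveI : CharZero (residueSubfield C V) :=
    (algebraMap (residueSubfield C V) (ResidueField V)).charZero
  haveI : PerfectField (residueSubfield C V) := PerfectField.ofCharZero
  have hHens : HenselianLocalRing (V.comap (algebraMap E Ω)) :=
    Kuhlmann2010HenselsLemma_holds _ _ hE
  set rbar := residue V ⟨r, hrV⟩ with hrbar
  have halg' : IsAlgebraic (residueSubfield C V) rbar := by
    rw [← resField_eq_residueSubfield]; exact halg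
  have hint : IsIntegral (residueSubfield C V) rbar := halg'.isIntegral
  set gbar := minpoly (residueSubfield C V) rbar with hgbar
  have hmon : gbar.Monic := minpoly.monic hint
  have hirr : Irreducible gbar := minpoly.irreducible hint
  have hsep : gbar.Separable := PerfectField.separable_of_irreducible hirr
  have hroot : aeval rbar gbar = 0 := minpoly.aeval _ _
  have hsimple : aeval rbar (derivative gbar) ≠ 0 := hsep.aeval_derivative_ne_zero hroot
  have hrbarE : rbar ∈ residueSubfield E V :=
    (mem_residueSubfield_iff E V _).mpr ⟨⟨r, hrE⟩, hrV, rfl⟩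
  obtain ⟨g, y, hyV, hgmon, -, -, hyE, hyg, hyres⟩ :=
    exists_root_lift_of_henselianLocalRing V hCE hHens gbar hmon hirr hrbarE hroot hsimple
  have hyalg : IsAlgebraic C y := ⟨g, hgmon.ne_zero, hyg⟩
  have hyC : y ∈ C := hrel y hyE hyalg
  rw [← hyres]
  exact residue_mem_resField V ⟨y, hyV⟩ hyC

/-- **Values: no new torsion values (residue characteristic `0`).** Under the same hypotheses,
if moreover every residue of `V ∩ E` is algebraic over `Cv`, then every `a ∈ E^×` whose value is
torsion modulo `vC`, say `|a^m| ∈ |C^×|` with `m ≠ 0`, has its value in `|C^×|`: `a^m = b'·u`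
with `b' ∈ C` and a unit `u` whose residue lies in `Cv`, so `u = c·wᵐ` with `c ∈ C` and a
`1`-unit `m`-th root `w ∈ E` (Hensel's Lemma, `m` being invertible in the residue field); then
`(a/w)^m = b'c ∈ C`, so `a/w ∈ C`, and `|a| = |a/w|`. [folklore] -/
theorem exists_valuation_eq_of_forall_isAlgebraic_mem_of_charZero {C E : Subfield Ω}
    (hCE : C ≤ E) (hE : IsHenselianField E (V.comap (algebraMap E Ω)))
    (hrel : ∀ a ∈ E, IsAlgebraic C a → a ∈ C)
    (hresalg : ∀ (r : Ω) (hrE : r ∈ E) (hrV : r ∈ V),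
      IsAlgebraic (resField V C) (residue V ⟨r, hrV⟩))
    {a : Ω} (haE : a ∈ E) (ha0 : a ≠ 0)
    (htors : ∃ n : ℕ, n ≠ 0 ∧ ∃ b ∈ C, V.valuation (a ^ n) = V.valuation b) :
    ∃ b ∈ C, V.valuation a = V.valuation b := by
  classical
  have hHens : HenselianLocalRing (V.comap (algebraMap E Ω)) :=
    Kuhlmann2010HenselsLemma_holds _ _ hE
  obtain ⟨m, hm0, b', hb'C, hb'⟩ := htors
  -- `a^m = b' u`, `u` a unit of `V ∩ E` with residue in `Cv`
  have ham0 : a ^ m ≠ 0 := pow_ne_zero _ ha0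
  have hb'0 : b' ≠ 0 := by
    rintro rfl
    rw [map_zero, map_eq_zero] at hb'
    exact ham0 hb'
  have hvb'0 : V.valuation b' ≠ 0 := (_root_.map_ne_zero _).mpr hb'0
  set u : Ω := a ^ m / b' with hu
  have huE : u ∈ E := div_mem (pow_mem haE m) (hCE hb'C)
  have hvu : V.valuation u = 1 := by rw [hu, map_div₀, hb', div_self hvb'0]
  have huV : u ∈ V := (V.valuation_le_one_iff u).mp hvu.le
  have hures : residue V ⟨u, huV⟩ ∈ resField V C :=
    residue_mem_resField_of_forall_isAlgebraic_mem_of_charZero V hCE hE hrel huE huV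
      (hresalg u huE huV)
  obtain ⟨c, hcC, hcu⟩ := (mem_resField_iff V C _).mp hures
  -- `c` is a unit and `u/c` a `1`-unit
  have hvuc : V.valuation (u - c) < 1 := (residue_eq_residue_iff V ⟨u, huV⟩ c).mp hcu.symm
  have hvc : V.valuation (c : Ω) = 1 := by
    have hid : (c : Ω) = u - (u - c) := by ring
    rw [hid, Valuation.map_sub_eq_of_lt_left _ (by rw [hvu]; exact hvuc), hvu]
  have hc0 : (c : Ω) ≠ 0 := fun h0 => by rw [h0, map_zero] at hvc; exact zero_ne_one hvc
  have h1u : V.valuation (u / c - 1) < 1 := by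
    have hid : u / c - 1 = (u - c) / c := by field_simp
    rw [hid, map_div₀, hvc, div_one]
    exact hvuc
  -- Hensel: `u/c = w^m`, `w` a `1`-unit of `E`
  have hmres : (m : ResidueField V) ≠ 0 := Nat.cast_ne_zero.mpr hm0
  obtain ⟨w, hwE, hwm, hw1⟩ :=
    exists_pow_eq_of_valuation_sub_one_lt V hHens hmres (div_mem huE (hCE hcC)) h1u
  have hvw : V.valuation w = 1 := by
    have hid : w = 1 + (w - 1) := by ring
    rw [hid, Valuation.map_add_eq_of_lt_left _ (by rw [Valuation.map_one]; exact hw1),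
      Valuation.map_one]
  -- `(a/w)^m = b' c ∈ C`, so `a/w ∈ C`
  have hpow : (a / w) ^ m = b' * c := by
    rw [div_pow, hwm, hu]
    field_simp
  have halg : IsAlgebraic C (a / w) := by
    refine ⟨X ^ m - Polynomial.C (⟨b' * c, C.mul_mem hb'C hcC⟩ : C), ?_, ?_⟩
    · exact (monic_X_pow_sub_C _ hm0).ne_zero
    · rw [map_sub, map_pow, aeval_X, aeval_C, hpow]
      exact sub_self _
  have hawC : a / w ∈ C := hrel _ (div_mem haE hwE) halg
  refine ⟨a / w, hawC, ?_⟩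
  rw [map_div₀, hvw, div_one]

/-- **A henselian extension of residue characteristic `0` in which the ground field is
algebraically closed, with torsion value group and algebraic residue field over it, is
IMMEDIATE** — the characteristic-`0` twin of `isImmediateOver_of_forall_isAlgebraic_mem`
(`RelAlgClosedImmediate.lean`; no perfectness hypothesis). [folklore] -/
theorem isImmediateOver_of_forall_isAlgebraic_mem_of_charZero {C E : Subfield Ω} (hCE : C ≤ E)
    (hE : IsHenselianField E (V.comap (algebraMap E Ω)))
    (hrel : ∀ a ∈ E, IsAlgebraic C a → a ∈ C)
    (htors : ∀ a ∈ E, a ≠ 0 → ∃ n : ℕ, n ≠ 0 ∧ ∃ b ∈ C, V.valuation (a ^ n) = V.valuation b)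
    (hresalg : ∀ (r : Ω) (hrE : r ∈ E) (hrV : r ∈ V),
      IsAlgebraic (resField V C) (residue V ⟨r, hrV⟩)) :
    IsImmediateOver V C E := by
  refine ⟨fun a haE ha0 => exists_valuation_eq_of_forall_isAlgebraic_mem_of_charZero V hCE hE
    hrel hresalg haE ha0 (htors a haE ha0), fun s hs => ?_⟩
  obtain ⟨r, hrE, rfl⟩ := (mem_resField_iff V E s).mp hs
  exact residue_mem_resField_of_forall_isAlgebraic_mem_of_charZero V hCE hE hrel hrE r.2
    (hresalg r hrE r.2)

end CharZero

/-! ### The algebraic part of the henselization of a transcendentally immediate function field -/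

section AlgebraicPart

variable [IsAlgClosed Ω]

/-- **`F^h` is immediate over `C = F^h ∩ k̃` (residue characteristic `0`).** For subfields
`k ≤ F` of `(Ω, V)` with `vF/vk` torsion (`IsValueTorsionOver`) and `Fv|kv` algebraic
(`IsResiduallyAlgebraicOver`), the henselization `F^h` is immediate over the subfield `C` of
its elements algebraic over `k`. [folklore] -/
theorem isImmediateOver_algebraicPart_henselization_of_charZero [CharZero (ResidueField V)]
    {k F : Subfield Ω} (hkF : k ≤ F) (htors : IsValueTorsionOver V k F)
    (hres : IsResiduallyAlgebraicOver V k F) :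
    IsImmediateOver V (henselization V F ⊓ (algebraicClosure k Ω).toSubfield)
      (henselization V F) := by
  set E : Subfield Ω := henselization V F with hEdef
  set C : Subfield Ω := E ⊓ (algebraicClosure k Ω).toSubfield with hCdef
  have hE : IsHenselianField E (V.comap (algebraMap E Ω)) :=
    Kuhlmann2010HenselizationIsHenselian_holds Ω V F
  have himmF : IsImmediateOver V F E := Kuhlmann2010HenselizationImmediate_holds Ω V F
  have hFE : F ≤ E := le_henselization V F
  have hCE : C ≤ E := inf_le_left
  have hkC : k ≤ C := fun c hc =>
    Subfield.mem_inf.mpr ⟨hFE (hkF hc), mem_algebraicClosure_iff.mpr (isAlgebraic_algebraMap (⟨c, hc⟩ : k))⟩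
  have hCalg : ∀ w ∈ C, IsAlgebraic k w := fun w hw =>
    mem_algebraicClosure_iff.mp (Subfield.mem_inf.mp hw).2
  refine isImmediateOver_of_forall_isAlgebraic_mem_of_charZero V hCE hE ?_ ?_ ?_
  · -- relative algebraic closedness of `C` in `E`
    intro a haE ha
    exact Subfield.mem_inf.mpr ⟨haE, mem_algebraicClosure_iff.mpr (isAlgebraic_trans_subfield hkC hCalg ha)⟩
  · -- torsion of `vE` over `vC`: `vE = vF` and `vF/vk` is torsion
    intro a haE ha0
    obtain ⟨b, hbF, hab⟩ := himmF.1 a haE ha0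
    have hb0 : b ≠ 0 := by
      rintro rfl
      rw [map_zero, map_eq_zero] at hab
      exact ha0 hab
    obtain ⟨n, hn0, c, hck, hbc⟩ := htors b hbF hb0
    refine ⟨n, hn0, c, hkC hck, ?_⟩
    rw [map_pow, hab, ← map_pow, hbc]
  · -- residues of `E` are residues of `F`, algebraic over `kv ≤ Cv`
    intro r hrE hrV
    have h1 : residue V ⟨r, hrV⟩ ∈ resField V F := himmF.2 (residue_mem_resField V ⟨r, hrV⟩ hrE)
    exact isAlgebraic_of_subfield_le (resField_mono V hkC) (hres _ h1)

/-! ### The valuative input of Thm. 3.3.1 in residue characteristic `0` -/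

/-- **Temkin 2013, Thm. 3.3.1 — its valuative input in residue characteristic `0`.** Let
`k ≤ F` be subfields of the algebraically closed valued field `(Ω, V)` of residue characteristic
`0`, with `F|k` finitely generated (`FGOver`) and algebraic over `k(t)` for some `t ∈ F`, `vF/vk`
torsion and `Fv|kv` algebraic (transcendentally immediate). Then there is a finite set `s` of
elements of `F^h` algebraic over `k` such that `F ≤ k(s)(t)^h = henselization V (k(s ∪ {t}))`.
(So, with `l = k` and `m = k(s)`: `m ≤ F^h`, `m|k` finite separable, and `F·m ≤ (m(t))^h`.)
[cite: Temkin2013, Thm. 3.3.1 (proof, Step 2) with Thms. 3.2.3, 3.2.6] [folklore] -/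
theorem exists_finset_le_henselization_closure_of_charZero [CharZero (ResidueField V)]
    {k F : Subfield Ω} (hkF : k ≤ F) (hfg : FGOver k F) {t : Ω} (htF : t ∈ F)
    (halg : ∀ z ∈ F, IsAlgebraic (IntermediateField.adjoin k ({t} : Set Ω)) z)
    (htors : IsValueTorsionOver V k F) (hres : IsResiduallyAlgebraicOver V k F) :
    ∃ s : Finset Ω, (↑s : Set Ω) ⊆ henselization V F ∧ (∀ y ∈ s, IsAlgebraic k y) ∧
      F ≤ henselization V (Subfield.closure ((k : Set Ω) ∪ ↑s ∪ {t})) := by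
  classical
  set E : Subfield Ω := henselization V F with hEdef
  set C : Subfield Ω := E ⊓ (algebraicClosure k Ω).toSubfield with hCdef
  have hFE : F ≤ E := le_henselization V F
  have hCE : C ≤ E := inf_le_left
  have hkC : k ≤ C := fun c hc =>
    Subfield.mem_inf.mpr ⟨hFE (hkF hc), mem_algebraicClosure_iff.mpr (isAlgebraic_algebraMap (⟨c, hc⟩ : k))⟩
  have hCalg : ∀ w ∈ C, IsAlgebraic k w := fun w hw =>
    mem_algebraicClosure_iff.mp (Subfield.mem_inf.mp hw).2
  have himmE : IsImmediateOver V C E :=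
    isImmediateOver_algebraicPart_henselization_of_charZero V hkF htors hres
  -- `F·C` is immediate over `C` and algebraic over `C(t)`
  set FC : Subfield Ω := F ⊔ C with hFCdef
  have hFCE : FC ≤ E := sup_le hFE hCE
  have himmFC : IsImmediateOver V C FC := himmE.mono_right hFCE
  have hCFC : C ≤ FC := le_sup_right
  have htFC : t ∈ FC := (le_sup_left : F ≤ FC) htF
  have halgFC : ∀ z ∈ FC, IsAlgebraic (IntermediateField.adjoin C ({t} : Set Ω)) z := by
    intro z hz
    rw [← isAlgebraic_closure_iff]
    have hz' : z ∈ Subfield.closure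
        ((Subfield.closure ((C : Set Ω) ∪ {t}) : Set Ω) ∪ ((F : Set Ω) ∪ (C : Set Ω))) := by
      have hle : FC ≤ Subfield.closure
          ((Subfield.closure ((C : Set Ω) ∪ {t}) : Set Ω) ∪ ((F : Set Ω) ∪ (C : Set Ω))) := by
        rw [hFCdef]
        refine sup_le (fun w hw => Subfield.subset_closure (Or.inr (Or.inl hw)))
          (fun w hw => Subfield.subset_closure (Or.inr (Or.inr hw)))
      exact hle hz
    refine isAlgebraic_of_mem_closure (fun w hw => ?_) hz'
    rcases hw with hwF | hwC
    · -- elements of `F` are algebraic over `k(t) ≤ C(t)`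
      have h1 : IsAlgebraic (Subfield.closure ((k : Set Ω) ∪ {t})) w :=
        (isAlgebraic_closure_iff k {t} w).mpr (halg w hwF)
      exact isAlgebraic_of_subfield_le
        (Subfield.closure_mono (Set.union_subset_union_left _ hkC)) h1
    · exact isAlgebraic_algebraMap
        (⟨w, Subfield.subset_closure (Or.inl hwC)⟩ : Subfield.closure ((C : Set Ω) ∪ {t}))
  have hp : ringExpChar (ResidueField V) = 1 := ringExpChar.eq_one _
  have hFC_le : FC ≤ henselization V (Subfield.closure ((C : Set Ω) ∪ {t})) :=
    le_henselization_closure_of_isImmediateOver V hCFC htFC halgFC himmFC hp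
  -- descent to a finite level `k(s)(t)`, `s ⊆ C`
  obtain ⟨G, hG⟩ := hfg
  have hGF : ∀ z ∈ G, z ∈ henselization V (Subfield.closure ((C : Set Ω) ∪ {t})) := fun z hz =>
    hFC_le ((le_sup_left : F ≤ FC) (hG ▸ Subfield.subset_closure (Or.inr hz)))
  obtain ⟨s, hsC, hs⟩ := exists_finset_closure_le_henselization_closure_levels V hkC {t}
    (B := (k : Set Ω)) (fun c hc => Subfield.subset_closure (Or.inl hc)) G hGF
  refine ⟨s, fun y hy => hCE (hsC hy), fun y hy => hCalg y (hsC hy), ?_⟩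
  rw [← hG]
  exact hs

end AlgebraicPart

end Literature.AlgebraicGeometry.Resolution

end
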